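import Literature.MathematicalPhysics.StatisticalMechanics.Theil2006DiscreteImbedding
import HarnessLib

/-!
# Theil 2006, Appendix Proposition 4.8 (3): surjectivity (62) of the reference configuration —
proof

Topic `Literature/MathematicalPhysics/StatisticalMechanics`; companion of `Theil2006.lean`
(F. Theil, *A proof of crystallization in two dimensions*, Comm. Math. Phys. **262** (2006)
209–236, accepted preprint of 26 Aug 2005, lit store `paper:url-69bff4ce1e30`), Appendix §4.2,
Proposition 4.8 (p. 21), assertion (3). PROVED, from the tree's Remark 2.5
(`Theil2006DiscreteImbedding.lean`: `IsDiscreteImbeddingOn.image_neighbours_eq`).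

## Source, as printed (preprint pp. 21, 23)

Proposition 4.8: "… there exists a discrete imbedding `Φ : ω → A₂`, where `ω = y⁻¹(Ω′)`.
Furthermore, the following assertions are true. […] (3) `Φ` is surjective in the sense that if
`B(y(x), r) ⊂ Ω′` for some `x ∈ X` and `r > 0`, then (62) `Φ(ω) ⊃ B(Φ(x), ½ r) ∩ A₂`."
Proof (p. 23): "Surjectivity (62) follows from the estimate above [(61)] together with the
invariance of domain theorem."  (Standing hypotheses: (13), `α < α₀`, `Ω ∩ y(∂X) = ∅`.)

## What is proved

`Theil2006.IsDiscreteImbeddingOn.exists_eq_of_dist_lt_half`: for ANY discrete imbedding `Φ`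
(Definition 2.4) of a patch `ω` containing all particles of the ball `B(y(x), r)`, no defect in
that ball, and `0 ≤ α ≤ 1/2`, every label `g ∈ ℤ²` with `|g − Φ(x)| < r/2` is attained,
`g = Φ(x″)` with `y(x″) ∈ B(y(x), r)` — i.e. (62), for every discrete imbedding of `ω` (not only
the one constructed in the proof), with `α₀ = 1/2`.  Ball-patch form matching
`Theil2006.IsReferenceOn.surjective`: `IsDiscreteImbeddingOn.exists_eq_of_ball_subset`.

The proof here is NOT the printed one (no rigidity estimate, no invariance of domain): by
Remark 2.5, around a non-defect `x′` whose neighbourhood `𝒩(x′)` lies in `ω` the imbedding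
attains all six lattice neighbours of `Φ(x′)`; an induction on the graph distance `n` of `g` from
`Φ(x)` in the triangular lattice (`n = max(|a|, |b|, |a+b|) ≤ (2/√3)|g − Φ(x)| < r/√3`, private
`hexLe`) produces `x″` within `n(1 + α) ≤ (3/2)·n < r` of `y(x)`, all hexagons met on the way
lying in the ball.  Also: `exists_eq_of_dist_lt_half'` (the same with the bound
`|y(x″) − y(x)| ≤ 2|g − Φ(x)|`) and `exists_isShortRange_of_labels` (labels at lattice distance `1`
near `Φ(x)` are realized by a short bond of the ball — the label triangulation is realized by
`𝒮`-bonds, Remark 2.5).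
-/

noncomputable section

namespace Literature.MathematicalPhysics.StatisticalMechanics

namespace Theil2006

open Metric Set

/-! ### The hexagonal (graph) norm of `A₂` in labels -/

section HexNorm

/-- `hexLe v n`: the label `v = (a, b)` has graph distance `≤ n` from the origin in the
triangular lattice with unit steps `unitShell`, i.e. `max(|a|, |b|, |a + b|) ≤ n`. [folklore] -/
private def hexLe (v : ℤ × ℤ) (n : ℕ) : Prop :=
  v.1 ≤ n ∧ -v.1 ≤ n ∧ v.2 ≤ n ∧ -v.2 ≤ n ∧ v.1 + v.2 ≤ n ∧ -(v.1 + v.2) ≤ n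

/-- Graph distance `0` means the origin. [folklore] -/
private theorem eq_zero_of_hexLe_zero {v : ℤ × ℤ} (h : hexLe v 0) : v = 0 := by
  obtain ⟨h1, h2, h3, h4, -, -⟩ := h
  ext <;> simp <;> omega

/-- One unit step reduces the graph distance. [folklore] -/
private theorem hexLe_step {v : ℤ × ℤ} {n : ℕ} (h : hexLe v (n + 1)) :
    hexLe v n ∨ ∃ u ∈ unitShell, hexLe (v - u) n := by
  obtain ⟨h1, h2, h3, h4, h5, h6⟩ := h
  by_cases hv : hexLe v n
  · exact Or.inl hv
  right
  simp only [hexLe, not_and_or, not_le] at hv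
  push_cast at h1 h2 h3 h4 h5 h6 hv
  rcases le_or_gt 1 v.1 with ha | ha <;> rcases le_or_gt 1 v.2 with hb | hb
  · refine ⟨(1, 0), by simp [unitShell], ?_⟩
    simp only [hexLe, Prod.fst_sub, Prod.snd_sub, sub_zero]
    omega
  · rcases le_or_gt 0 v.2 with hb' | hb'
    · refine ⟨(1, 0), by simp [unitShell], ?_⟩
      simp only [hexLe, Prod.fst_sub, Prod.snd_sub, sub_zero]
      omega
    · refine ⟨(1, -1), by simp [unitShell], ?_⟩
      simp only [hexLe, Prod.fst_sub, Prod.snd_sub, sub_neg_eq_add]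
      omega
  · rcases le_or_gt 0 v.1 with ha' | ha'
    · refine ⟨(0, 1), by simp [unitShell], ?_⟩
      simp only [hexLe, Prod.fst_sub, Prod.snd_sub, sub_zero]
      omega
    · refine ⟨(-1, 1), by simp [unitShell], ?_⟩
      simp only [hexLe, Prod.fst_sub, Prod.snd_sub, sub_neg_eq_add]
      omega
  · -- `v.1 ≤ 0`, `v.2 ≤ 0`
    rcases le_or_gt v.1 (-1) with ha' | ha'
    · refine ⟨(-1, 0), by simp [unitShell], ?_⟩
      simp only [hexLe, Prod.fst_sub, Prod.snd_sub, sub_zero, sub_neg_eq_add]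
      omega
    · refine ⟨(0, -1), by simp [unitShell], ?_⟩
      simp only [hexLe, Prod.fst_sub, Prod.snd_sub, sub_zero, sub_neg_eq_add]
      omega

/-- The graph distance is at most `2/√3` times the Euclidean one:
`3 n² ≤ 4 (a² + ab + b²)` for `n = max(|a|, |b|, |a+b|)`. [folklore] -/
private theorem exists_hexLe_sq_le (v : ℤ × ℤ) :
    ∃ n : ℕ, hexLe v n ∧ 3 * (n : ℤ) ^ 2 ≤ 4 * (v.1 ^ 2 + v.1 * v.2 + v.2 ^ 2) := by
  have key : ∀ t : ℤ, (t = v.1 ∨ t = v.2 ∨ t = v.1 + v.2) →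
      3 * t ^ 2 ≤ 4 * (v.1 ^ 2 + v.1 * v.2 + v.2 ^ 2) := by
    rintro t (rfl | rfl | rfl)
    · nlinarith [sq_nonneg (v.1 + 2 * v.2)]
    · nlinarith [sq_nonneg (2 * v.1 + v.2)]
    · nlinarith [sq_nonneg (v.1 - v.2)]
  -- the largest of `|a|, |b|, |a+b|`
  rcases le_or_gt |v.2| |v.1| with h12 | h12
  · rcases le_or_gt |v.1 + v.2| |v.1| with h13 | h13
    · refine ⟨(v.1).natAbs, ?_, ?_⟩
      · simp only [hexLe, Int.natCast_natAbs]
        refine ⟨le_abs_self _, neg_le_abs _, ?_, ?_, ?_, ?_⟩ <;>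
          linarith [le_abs_self v.2, neg_le_abs v.2, le_abs_self (v.1 + v.2),
            neg_le_abs (v.1 + v.2)]
      · rw [Int.natCast_natAbs, sq_abs]; exact key _ (Or.inl rfl)
    · refine ⟨(v.1 + v.2).natAbs, ?_, ?_⟩
      · simp only [hexLe, Int.natCast_natAbs]
        refine ⟨?_, ?_, ?_, ?_, le_abs_self _, neg_le_abs _⟩ <;>
          linarith [le_abs_self v.2, neg_le_abs v.2, le_abs_self v.1, neg_le_abs v.1]
      · rw [Int.natCast_natAbs, sq_abs]; exact key _ (Or.inr (Or.inr rfl))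
  · rcases le_or_gt |v.1 + v.2| |v.2| with h23 | h23
    · refine ⟨(v.2).natAbs, ?_, ?_⟩
      · simp only [hexLe, Int.natCast_natAbs]
        refine ⟨?_, ?_, le_abs_self _, neg_le_abs _, ?_, ?_⟩ <;>
          linarith [le_abs_self v.1, neg_le_abs v.1, le_abs_self (v.1 + v.2),
            neg_le_abs (v.1 + v.2)]
      · rw [Int.natCast_natAbs, sq_abs]; exact key _ (Or.inr (Or.inl rfl))
    · refine ⟨(v.1 + v.2).natAbs, ?_, ?_⟩
      · simp only [hexLe, Int.natCast_natAbs]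
        refine ⟨?_, ?_, ?_, ?_, le_abs_self _, neg_le_abs _⟩ <;>
          linarith [le_abs_self v.2, neg_le_abs v.2, le_abs_self v.1, neg_le_abs v.1]
      · rw [Int.natCast_natAbs, sq_abs]; exact key _ (Or.inr (Or.inr rfl))

end HexNorm

/-! ### (62): surjectivity of discrete imbeddings of defect-free balls -/

section Surjective

variable {X : Type*} {α : ℝ} {y : X → Plane} {ω : Set X} {Φ : X → ℤ × ℤ}

/-- The induction behind (62): a label at graph distance `≤ n` from `Φ(x)` is attained by a
particle within `n(1 + α)` of `y(x)`, as long as `n(1 + α) < r` (the hexagons met on the way lie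
in `B(y(x), r) ⊂ Ω′`, Remark 2.5). [cite: Theil2006, §4.2 Proposition 4.8 (3) (62)
(preprint p. 21); our induction] -/
private theorem exists_eq_of_hexLe (hΦ : IsDiscreteImbeddingOn α y ω Φ) (hα0 : 0 ≤ α)
    (hα : α < 1) {x : X}
    {r : ℝ} (hball : ∀ b, dist (y b) (y x) < r → b ∈ ω)
    (hdef : ∀ b, dist (y b) (y x) < r → b ∉ defectSet α y) :
    ∀ n : ℕ, (n : ℝ) * (1 + α) < r → ∀ g : ℤ × ℤ, hexLe (g - Φ x) n →
      ∃ x'' : X, dist (y x'') (y x) ≤ n * (1 + α) ∧ Φ x'' = g := by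
  intro n
  induction n with
  | zero =>
    intro _ g hg
    refine ⟨x, by simp, ?_⟩
    have := eq_zero_of_hexLe_zero hg
    rwa [sub_eq_zero, eq_comm] at this
  | succ n ih =>
    intro hr g hg
    have hr' : (n : ℝ) * (1 + α) < r := by
      refine lt_of_le_of_lt ?_ hr
      push_cast
      nlinarith
    rcases hexLe_step hg with h | ⟨u, hu, h⟩
    · obtain ⟨x'', hd, hx''⟩ := ih hr' g h
      exact ⟨x'', hd.trans (by push_cast; nlinarith), hx''⟩
    · rw [sub_right_comm] at h
      obtain ⟨x', hd, hx'⟩ := ih hr' (g - u) h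
      -- the hexagon of `x'` lies in the ball
      have hx'def : x' ∉ defectSet α y := hdef x' (lt_of_le_of_lt hd hr')
      have hN : nbhdSet α y x' ⊆ ω := by
        intro b hb
        rw [mem_nbhdSet_iff] at hb
        rcases hb with rfl | hb
        · exact hball _ (lt_of_le_of_lt hd hr')
        · refine hball b (lt_of_le_of_lt ?_ hr)
          calc dist (y b) (y x) ≤ dist (y b) (y x') + dist (y x') (y x) := dist_triangle _ _ _
            _ ≤ (1 + α) + n * (1 + α) := by
                gcongr
                rw [dist_comm]; exact hb.dist_le
            _ = ((n + 1 : ℕ) : ℝ) * (1 + α) := by push_cast; ring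
      have himg := hΦ.image_neighbours_eq hα hx'def hN
      have hg1 : g ∈ {k' : ℤ × ℤ | dist (triPoint (Φ x')) (triPoint k') = 1} := by
        show dist (triPoint (Φ x')) (triPoint g) = 1
        rw [hx', dist_triPoint, sub_sub_cancel_left, map_neg, norm_neg]
        exact norm_triPoint_of_mem_unitShell hu
      rw [← himg] at hg1
      obtain ⟨x'', hx''s, hx''g⟩ := hg1
      refine ⟨x'', ?_, hx''g⟩
      calc dist (y x'') (y x) ≤ dist (y x'') (y x') + dist (y x') (y x) := dist_triangle _ _ _
        _ ≤ (1 + α) + n * (1 + α) := by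
            gcongr
            rw [dist_comm]; exact IsShortRange.dist_le hx''s
        _ = ((n + 1 : ℕ) : ℝ) * (1 + α) := by push_cast; ring

/-- **Proposition 4.8 (3), (62) (Theil 2006, Appendix): surjectivity — proved.**  "`Φ` is
surjective in the sense that if `B(y(x), r) ⊂ Ω′` for some `x ∈ X` and `r > 0`, then
(62) `Φ(ω) ⊃ B(Φ(x), ½ r) ∩ A₂`."  Here: `Φ` a discrete imbedding (Definition 2.4) of a patch `ω`
containing every particle of the ball `B(y(x), r)`, no defect in that ball (`Ω ∩ y(∂X) = ∅`), and
`α ≤ 1/2`; then every label `g` with `|g − Φ(x)| < r/2` is `Φ(x″)` for a particle `x″` of the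
ball.  The print derives (62) from the rigidity estimate and the invariance of domain theorem;
this proof is combinatorial (Remark 2.5: around a non-defect whose hexagon lies in `ω`, `Φ` attains
all six lattice neighbours; induction on the graph distance `≤ (2/√3)|g − Φ(x)|`), so neither (61)
nor `α ≤ α₀` beyond `α ≤ 1/2` is needed. [cite: Theil2006, §4.2 Proposition 4.8 (3) (62)
(preprint p. 21)] -/
theorem IsDiscreteImbeddingOn.exists_eq_of_dist_lt_half (hΦ : IsDiscreteImbeddingOn α y ω Φ)
    (hα0 : 0 ≤ α) (hα : α ≤ 1 / 2) {x : X} {r : ℝ} (hball : ∀ b, dist (y b) (y x) < r → b ∈ ω)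
    (hdef : ∀ b, dist (y b) (y x) < r → b ∉ defectSet α y) {g : ℤ × ℤ}
    (hg : dist (triPoint g) (triPoint (Φ x)) < r / 2) :
    ∃ x'' : X, dist (y x'') (y x) < r ∧ Φ x'' = g := by
  obtain ⟨n, hn, hsq⟩ := exists_hexLe_sq_le (g - Φ x)
  have hd : dist (triPoint g) (triPoint (Φ x)) ^ 2 =
      (((g - Φ x).1 ^ 2 + (g - Φ x).1 * (g - Φ x).2 + (g - Φ x).2 ^ 2 : ℤ) : ℝ) := by
    rw [dist_triPoint, norm_triPoint_sq]
  have hsq' : 3 * (n : ℝ) ^ 2 ≤ 4 * dist (triPoint g) (triPoint (Φ x)) ^ 2 := by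
    rw [hd]; exact_mod_cast hsq
  have h0 : 0 ≤ dist (triPoint g) (triPoint (Φ x)) := dist_nonneg
  have hr0 : 0 < r := by linarith
  have hnr : (n : ℝ) * (1 + α) < r := by
    have h1 : 0 ≤ (n : ℝ) := Nat.cast_nonneg n
    have h4 : 4 * dist (triPoint g) (triPoint (Φ x)) ^ 2 < r ^ 2 := by nlinarith
    have h5 : (n : ℝ) * (1 + α) ≤ n * (3 / 2) := by gcongr; linarith
    have h7 : 0 ≤ (n : ℝ) * (1 + α) := by positivity
    have h6 : ((n : ℝ) * (1 + α)) ^ 2 < r ^ 2 := by nlinarith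
    exact lt_of_abs_lt (abs_lt_of_sq_lt_sq h6 hr0.le)
  obtain ⟨x'', hdist, hx''⟩ := exists_eq_of_hexLe hΦ hα0 (by linarith) hball hdef n hnr g hn
  exact ⟨x'', lt_of_le_of_lt hdist hnr, hx''⟩

/-- **(62) on a ball patch**, in the form used for reference configurations
(`Theil2006.IsReferenceOn.surjective`): for a discrete imbedding `Φ` of `ω = y⁻¹(B(c, r))` with
no defect in `B(c, r)` (`α ≤ 1/2`), every `x` and `ρ > 0` with `B(y(x), ρ) ⊂ B(c, r)`, and every
label `g` with `|g − Φ(x)| < ρ/2`, there is `x″ ∈ ω` with `Φ(x″) = g`.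
[cite: Theil2006, §4.2 Proposition 4.8 (3) (62) (preprint p. 21)] -/
theorem IsDiscreteImbeddingOn.exists_eq_of_ball_subset
    {c : Plane} {r : ℝ} (hΦ : IsDiscreteImbeddingOn α y (y ⁻¹' ball c r) Φ) (hα0 : 0 ≤ α)
    (hα : α ≤ 1 / 2)
    (hdef : ∀ b ∈ defectSet α y, r ≤ dist (y b) c) (x : X) (ρ : ℝ) (hρ : 0 < ρ)
    (hsub : ball (y x) ρ ⊆ ball c r) (g : ℤ × ℤ)
    (hg : dist (triPoint g) (triPoint (Φ x)) < ρ / 2) :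
    ∃ x'' : X, y x'' ∈ ball c r ∧ Φ x'' = g := by
  have _ := hρ
  obtain ⟨x'', hd, hx''⟩ := hΦ.exists_eq_of_dist_lt_half hα0 hα
    (fun b hb => show y b ∈ ball c r from hsub (mem_ball.2 hb))
    (fun b hb hbdef => by
      have h1 := hdef b hbdef
      have h2 := mem_ball.1 (hsub (mem_ball.2 hb))
      linarith) hg
  exact ⟨x'', hsub (mem_ball.2 hd), hx''⟩

/-- **(62) with the distance bookkeeping of its proof**: the particle `x″` with `Φ(x″) = g`
can be taken within `2|g − Φ(x)|` of `y(x)` (graph distance `n ≤ (2/√3)|g − Φ(x)|`, each step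
of length `≤ 1 + α ≤ 3/2`). Same hypotheses as `exists_eq_of_dist_lt_half`.
[cite: Theil2006, §4.2 Proposition 4.8 (3) (62) (preprint p. 21); our bookkeeping] -/
theorem IsDiscreteImbeddingOn.exists_eq_of_dist_lt_half' (hΦ : IsDiscreteImbeddingOn α y ω Φ)
    (hα0 : 0 ≤ α) (hα : α ≤ 1 / 2) {x : X} {r : ℝ} (hball : ∀ b, dist (y b) (y x) < r → b ∈ ω)
    (hdef : ∀ b, dist (y b) (y x) < r → b ∉ defectSet α y) {g : ℤ × ℤ}
    (hg : dist (triPoint g) (triPoint (Φ x)) < r / 2) :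
    ∃ x'' : X, dist (y x'') (y x) ≤ 2 * dist (triPoint g) (triPoint (Φ x)) ∧ Φ x'' = g := by
  obtain ⟨n, hn, hsq⟩ := exists_hexLe_sq_le (g - Φ x)
  have hd : dist (triPoint g) (triPoint (Φ x)) ^ 2 =
      (((g - Φ x).1 ^ 2 + (g - Φ x).1 * (g - Φ x).2 + (g - Φ x).2 ^ 2 : ℤ) : ℝ) := by
    rw [dist_triPoint, norm_triPoint_sq]
  have hsq' : 3 * (n : ℝ) ^ 2 ≤ 4 * dist (triPoint g) (triPoint (Φ x)) ^ 2 := by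
    rw [hd]; exact_mod_cast hsq
  have h0 : 0 ≤ dist (triPoint g) (triPoint (Φ x)) := dist_nonneg
  have h1 : 0 ≤ (n : ℝ) := Nat.cast_nonneg n
  -- `n (1 + α) ≤ (3/2) n ≤ 2 d`
  have hn2 : (n : ℝ) * (1 + α) ≤ 2 * dist (triPoint g) (triPoint (Φ x)) := by
    have h5 : (n : ℝ) * (1 + α) ≤ n * (3 / 2) := by gcongr; linarith
    have h6 : ((n : ℝ) * (3 / 2)) ^ 2 ≤ (2 * dist (triPoint g) (triPoint (Φ x))) ^ 2 := by
      nlinarith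
    have h7 := abs_le_of_sq_le_sq' h6 (by positivity)
    exact h5.trans h7.2
  have hnr : (n : ℝ) * (1 + α) < r := lt_of_le_of_lt hn2 (by linarith)
  obtain ⟨x'', hdist, hx''⟩ := exists_eq_of_hexLe hΦ hα0 (by linarith) hball hdef n hnr g hn
  exact ⟨x'', hdist.trans hn2, hx''⟩

/-- **Realized bonds.** Under the hypotheses of (62) (a discrete imbedding `Φ` of a patch
containing the particles of `B(y(x), r)`, no defect there, `0 ≤ α ≤ 1/2`), two labels `g, g′`
at lattice distance `1` with `|g − Φ(x)| < r/2 − 1` are the labels of a short bond `{p, q}` of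
particles of the ball: the lattice triangulation near `Φ(x)` is realized by `𝒮`-bonds (Remark 2.5
at `p`, whose neighbourhood lies in the ball). [cite: Theil2006, §4.2 Proposition 4.8 (3) (62)
with §2.3 Remark 2.5 (preprint pp. 7, 21); our lemma] -/
theorem IsDiscreteImbeddingOn.exists_isShortRange_of_labels (hΦ : IsDiscreteImbeddingOn α y ω Φ)
    (hα0 : 0 ≤ α) (hα : α ≤ 1 / 2) {x : X} {r : ℝ} (hball : ∀ b, dist (y b) (y x) < r → b ∈ ω)
    (hdef : ∀ b, dist (y b) (y x) < r → b ∉ defectSet α y) {g g' : ℤ × ℤ}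
    (hg : dist (triPoint g) (triPoint (Φ x)) < r / 2 - 1)
    (hgg' : dist (triPoint g) (triPoint g') = 1) :
    ∃ p q : X, dist (y p) (y x) < r ∧ dist (y q) (y x) < r ∧ Φ p = g ∧ Φ q = g' ∧
      IsShortRange α y p q := by
  have hα1 : α < 1 := by linarith
  have h0 : 0 ≤ dist (triPoint g) (triPoint (Φ x)) := dist_nonneg
  obtain ⟨p, hpd, hp⟩ := hΦ.exists_eq_of_dist_lt_half' hα0 hα hball hdef (g := g) (by linarith)
  have hpr : dist (y p) (y x) < r - 2 := by linarith
  have hpdef : p ∉ defectSet α y := hdef p (by linarith)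
  have hN : nbhdSet α y p ⊆ ω := by
    intro b hb
    rw [mem_nbhdSet_iff] at hb
    rcases hb with rfl | hb
    · exact hball _ (by linarith)
    · refine hball b ?_
      calc dist (y b) (y x) ≤ dist (y b) (y p) + dist (y p) (y x) := dist_triangle _ _ _
        _ ≤ (1 + α) + dist (y p) (y x) := by
            gcongr
            rw [dist_comm]; exact hb.dist_le
        _ < r := by linarith
  have himg := hΦ.image_neighbours_eq hα1 hpdef hN
  have hg1 : g' ∈ {k' : ℤ × ℤ | dist (triPoint (Φ p)) (triPoint k') = 1} := by
    show dist (triPoint (Φ p)) (triPoint g') = 1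
    rw [hp]; exact hgg'
  rw [← himg] at hg1
  obtain ⟨q, hq, hqg⟩ := hg1
  refine ⟨p, q, by linarith, ?_, hp, hqg, hq⟩
  calc dist (y q) (y x) ≤ dist (y q) (y p) + dist (y p) (y x) := dist_triangle _ _ _
    _ ≤ (1 + α) + dist (y p) (y x) := by
        gcongr
        rw [dist_comm]; exact IsShortRange.dist_le hq
    _ < r := by linarith

/-- **(62) with the sharp Euclidean/graph conversion factor of its proof.** Same hypotheses as
`exists_eq_of_dist_lt_half` except the range condition: a label `g` is attained by a particle `x″`
with `|y(x″) − y(x)| ≤ (2/√3)(1 + α)|g − Φ(x)|` as soon as `(2/√3)(1 + α)|g − Φ(x)| < r` (graph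
distance `n ≤ (2/√3)|g − Φ(x)|`, each of the `n` steps of length `≤ 1 + α`; `0 ≤ α < 1`). This is
the form used for the rigidity estimate (61), where the radii bookkeeping of Proposition 4.8
cannot afford the factor `2`. [cite: Theil2006, §4.2 Proposition 4.8 (3) (62) (preprint p. 21);
our bookkeeping] -/
theorem IsDiscreteImbeddingOn.exists_eq_of_dist_lt_sharp (hΦ : IsDiscreteImbeddingOn α y ω Φ)
    (hα0 : 0 ≤ α) (hα : α < 1) {x : X} {r : ℝ} (hball : ∀ b, dist (y b) (y x) < r → b ∈ ω)
    (hdef : ∀ b, dist (y b) (y x) < r → b ∉ defectSet α y) {g : ℤ × ℤ}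
    (hg : 2 / √3 * (1 + α) * dist (triPoint g) (triPoint (Φ x)) < r) :
    ∃ x'' : X, dist (y x'') (y x) ≤ 2 / √3 * (1 + α) * dist (triPoint g) (triPoint (Φ x)) ∧
      Φ x'' = g := by
  obtain ⟨n, hn, hsq⟩ := exists_hexLe_sq_le (g - Φ x)
  have hd : dist (triPoint g) (triPoint (Φ x)) ^ 2 =
      (((g - Φ x).1 ^ 2 + (g - Φ x).1 * (g - Φ x).2 + (g - Φ x).2 ^ 2 : ℤ) : ℝ) := by
    rw [dist_triPoint, norm_triPoint_sq]
  have hsq' : 3 * (n : ℝ) ^ 2 ≤ 4 * dist (triPoint g) (triPoint (Φ x)) ^ 2 := by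
    rw [hd]; exact_mod_cast hsq
  have h0 : 0 ≤ dist (triPoint g) (triPoint (Φ x)) := dist_nonneg
  have h1 : 0 ≤ (n : ℝ) := Nat.cast_nonneg n
  have h3 : 0 < √3 := Real.sqrt_pos.2 (by norm_num)
  have h33 : (√3 : ℝ) ^ 2 = 3 := Real.sq_sqrt (by norm_num)
  -- `n ≤ (2/√3) d`
  have hn2 : (n : ℝ) ≤ 2 / √3 * dist (triPoint g) (triPoint (Φ x)) := by
    rw [div_mul_eq_mul_div, le_div_iff₀ h3]
    have h6 : ((n : ℝ) * √3) ^ 2 ≤ (2 * dist (triPoint g) (triPoint (Φ x))) ^ 2 := by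
      rw [mul_pow, h33]; nlinarith
    exact (abs_le_of_sq_le_sq' h6 (by positivity)).2
  have hn3 : (n : ℝ) * (1 + α) ≤ 2 / √3 * (1 + α) * dist (triPoint g) (triPoint (Φ x)) := by
    have h1α : 0 ≤ 1 + α := by linarith
    calc (n : ℝ) * (1 + α) ≤ 2 / √3 * dist (triPoint g) (triPoint (Φ x)) * (1 + α) :=
          mul_le_mul_of_nonneg_right hn2 h1α
      _ = 2 / √3 * (1 + α) * dist (triPoint g) (triPoint (Φ x)) := by ring
  have hnr : (n : ℝ) * (1 + α) < r := lt_of_le_of_lt hn3 hg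
  obtain ⟨x'', hdist, hx''⟩ := exists_eq_of_hexLe hΦ hα0 hα hball hdef n hnr g hn
  exact ⟨x'', hdist.trans hn3, hx''⟩

/-- **(62) verbatim, as the printed set inclusion `Φ(ω) ⊃ B(Φ(x), ½ r) ∩ A₂`.** Under the
hypotheses of `exists_eq_of_dist_lt_half` (`Φ` a discrete imbedding (Definition 2.4) of a patch
`ω` containing every particle of `B(y(x), r)`, no defect in `B(y(x), r)`, `0 ≤ α ≤ 1/2`), with the
lattice `A₂` parametrized by the labels `ℤ × ℤ` through `triPoint`:
`B(Φ(x), r/2) ∩ A₂ ⊆ Φ(ω)`, i.e.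
`ball (triPoint (Φ x)) (r/2) ∩ range triPoint ⊆ triPoint '' (Φ '' ω)`. (The print's standing
hypotheses are (13), `α < α₀`, `Ω ∩ y(∂X) = ∅` and `B(y(x), r) ⊂ Ω′`, `ω = y⁻¹(Ω′)`; here they
enter only through `hball`/`hdef`, for ANY discrete imbedding of `ω`.)
[cite: Theil2006, §4.2 Proposition 4.8 (3) (62) (preprint p. 21)] -/
theorem IsDiscreteImbeddingOn.ball_inter_range_triPoint_subset (hΦ : IsDiscreteImbeddingOn α y ω Φ)
    (hα0 : 0 ≤ α) (hα : α ≤ 1 / 2) {x : X} {r : ℝ} (hball : ∀ b, dist (y b) (y x) < r → b ∈ ω)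
    (hdef : ∀ b, dist (y b) (y x) < r → b ∉ defectSet α y) :
    ball (triPoint (Φ x)) (r / 2) ∩ range (triPoint : ℤ × ℤ → Plane) ⊆ triPoint '' (Φ '' ω) := by
  rintro _ ⟨hq, g, rfl⟩
  obtain ⟨x'', hd, hx''⟩ := hΦ.exists_eq_of_dist_lt_half hα0 hα hball hdef (g := g) (mem_ball.1 hq)
  exact ⟨g, ⟨x'', hball x'' hd, hx''⟩, rfl⟩

/-- **(62) in labels, with the localisation its proof gives**: every label `g ∈ ℤ × ℤ` with
`|g − Φ(x)| < r/2` is the label of a particle OF THE BALL `B(y(x), r)` (not merely of `ω`):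
`{g | |g − Φ(x)| < r/2} ⊆ Φ(ω ∩ y⁻¹B(y(x), r))`. Same hypotheses.
[cite: Theil2006, §4.2 Proposition 4.8 (3) (62) (preprint p. 21); our bookkeeping] -/
theorem IsDiscreteImbeddingOn.labelBall_subset_image (hΦ : IsDiscreteImbeddingOn α y ω Φ)
    (hα0 : 0 ≤ α) (hα : α ≤ 1 / 2) {x : X} {r : ℝ} (hball : ∀ b, dist (y b) (y x) < r → b ∈ ω)
    (hdef : ∀ b, dist (y b) (y x) < r → b ∉ defectSet α y) :
    {g : ℤ × ℤ | dist (triPoint g) (triPoint (Φ x)) < r / 2} ⊆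
      Φ '' (ω ∩ {b : X | dist (y b) (y x) < r}) := by
  intro g hg
  obtain ⟨x'', hd, hx''⟩ := hΦ.exists_eq_of_dist_lt_half hα0 hα hball hdef (g := g) hg
  exact ⟨x'', ⟨hball x'' hd, hd⟩, hx''⟩

end Surjective

end Theil2006

end Literature.MathematicalPhysics.StatisticalMechanics
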